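/-
Copyright (c) 2026 the pub-hodgecm-mathlib formalisation cell (harness21).  Prover seat hodgecm-mathlib-F0P3b-p01 (g13): «S3-ram» seeding wave (LEAD F0P3a-plan (g12)
T11-41; owner F0P3a-p06 (g15)), row «A′ (iv) Δ‴ ON THE FOUR RAMIFIED LITERALS» (architect A-p16 (g31) deal 22:49:18Z); 2026-09-01.
-/
import Literature.NumberTheory.Rogawski1990.UnitFundamentalLemmaNonsplitFourClassesAssembly   -- ★ p847076 (this seat): the place-generic four-classes assembly (`… = finTau·finWeylRatio·Σ_b κ_b·Φ_b`), the frame bridge∕adapter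
import Literature.NumberTheory.Rogawski1990.FinExplicitTransferFactorDeepTauTamePairs        -- ★ T5-u-TAME (F0P3a-p04): `exists_nhds_one_forall_finExplicitDelta_eq_hilbertSymbol_mul` (`Δ‴ = (β, θ)_v · q_v^{−m} · κ` near `1`, ramified allowed)
import HarnessLib

/-!
# `Δ‴_v` on the four matched representatives of a type-(1) class at a TAME place (ramified allowed): near `1`,
# `∑ᶠ c, Δ‴_v(γ_H, out c)·Φ(c, f) = (β(γ_H), θ)_v · q_v^{−m} · s · ∑_{b₀ b₁} (−1)^{b₁}·Φ(⟦t_b⟧, f)` (Rogawski 1990 §4.9, (4.3.1)–(4.3.2); Labesse–Langlands §2)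

Topic `NumberTheory/Rogawski1990`; namespace `Literature.NumberTheory.Rogawski1990`.  THEOREMS ONLY (no definition, no named fact, no instance, no notation, no `sorry`).
Cell `pub/hodgecm-mathlib`, crux H413 (`--supports stmt-HodgeConjecture-24833`), «S3-ram» seeding wave, row **«A′ (iv) Δ‴ ON THE FOUR RAMIFIED LITERALS»** (A-p16 (g31)'s
«P-1-ram» skeleton v4, STUB A′ sub-organ (iv); the last organ of A′ besides the counts (ii)).  Inputs BY NAME: ★ p847076 (assembly: the four matched, pairwise non-conjugate
classes exhaust `Δ‴`'s support and `Δ‴ = τ·D·κ` by definition), ★ T5-u-TAME (the factor `τ·D = (β, θ)_v · q_v^{−m}` on matched pairs near `1`, `β(γ_H)` the `σ_w`-fixed symmetrised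
discriminant, `|χ_g(u)_w| = |ι_w ϖ_v|^m` the depth token), ★ p846987 (the signs `κ_v(γ_H, t_b) = s·(−1)^{b₁}`, `s = χ(−det H′_w)` — entered here as a HYPOTHESIS `hκ` so that this
file is literal-agnostic).  HONEST LABEL: HC_CM is proved only modulo the 2 remaining named inputs (hLiu418 24832, h413 24833) until rung 0 closes; no books consequence.

**Contents.**
* §1 `finTau_mul_finWeylRatio_eq_of_finExplicitDelta_eq` — from ONE matched `γ′` with `κ_v(γ_H, γ′) = ±1` and a value `Δ‴_v(γ_H, γ′) = C · κ_v(γ_H, γ′)`: `τ_v(γ_H)·D_v(γ_H) = C`.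
* §2 **`exists_nhds_one_forall_finsum_delta_eq_hilbertSymbol_mul_signed_sum`** — `∃ V ∈ 𝓝 1, ∀ γ_H ∈ V`: for the depth token `m`, the symmetrised discriminant `β`, four
  matched pairwise non-conjugate representatives `t : Fin 2 → Fin 2 → G′_v` with a one-place type-(1) eigenframe of `t 0 0` and signs `κ_v(γ_H, t_b) = s·(−1)^{b₁}` (`s = ±1`):
  `∑ᶠ c, Δ‴_v(γ_H, out c)·Φ(c, f) = (β, θ)_v · (q_v^m)⁻¹ · s · ∑_{b₀} ∑_{b₁} (−1)^{b₁} · Φ(⟦t b₀ b₁⟧, f)` for ANY `f`, ANY orbital-measure family — the `G′`-side of STUB A′ with the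
  common factor EVALUATED (Rogawski's `τ(γ_H)` is the Hilbert symbol `(β(γ_H), θ)_v`, which at a ramified `v` depends on the residue class of `β`, not only on the depths —
  the sign `ε(γ_H)` of the certificate «P1ram-T0», A-p16 (g31) 22:49:55Z).

## References
* [Rogawski1990] J. D. Rogawski, *Automorphic Representations of Unitary Groups in Three Variables*, Ann. of Math. Stud. 123 (1990), §4.3 (4.3.1)–(4.3.2) p. 43, §4.9 p. 55,
  Prop. 4.9.1 p. 55, Lemma 4.9.3 p. 56, Prop. 8.1.3 p. 116.
* [LabesseLanglands1979] J.-P. Labesse, R. P. Langlands, *L-indistinguishability for SL(2)*, Canad. J. Math. 31 (1979), §2 (2.1)–(2.2).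
* [Flicker1998UnitaryFL] Y. Z. Flicker, *Elementary proof of the fundamental lemma for a unitary group*, Canad. J. Math. 50 (1998), §6 p. 95.
-/

set_option autoImplicit false

noncomputable section

open NumberField IsDedekindDomain Matrix Filter Topology
open scoped MatrixGroups

namespace Literature.NumberTheory.Rogawski1990

open Literature.NumberTheory.Automorphic Literature.NumberTheory.Automorphic.UnitaryGroup
open Literature.NumberTheory.GaloisRepresentations Literature.NumberTheory.NumberFields Literature.NumberTheory.QuadraticForms

section Literals

variable (L : Type) [Field L] [NumberField L] [IsCMField L] (v : HeightOneSpectrum (𝓞 ↥(maximalRealSubfield L)))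
  (H' : Matrix (Fin 3) (Fin 3) L)
  (w : UnitaryGroup.PlacesOver L v) (hw : IsCMField.complexConj L • w.1 = w.1)
  (μ : HeckeCharacter L)

/-! ## §1 Reading the common factor `τ·D` off one matched value -/

/-- **The common factor from one matched value**: if `ι_v(γ_H) ↔ γ′` with `κ_v(γ_H, γ′) = s ∈ {±1}` and `Δ‴_v(γ_H, γ′) = C · κ_v(γ_H, γ′)`, then `τ_v(γ_H, μ) · D_v(γ_H) = C`
(★ `finExplicitDelta_of_isLocalNormPair`: `Δ‴ = τ·D·κ`, and `κ ≠ 0`). [cite: Rogawski1990, §4.3 (4.3.1) p. 43; §4.9 p. 55] -/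
theorem finTau_mul_finWeylRatio_eq_of_finExplicitDelta_eq
    (a : (UnitaryGroup.cmDatum L 2 (Matrix.of fun i j : Fin 2 => if i.val + j.val + 1 = 2 then (1 : L) else 0)).Local v ×
      (UnitaryGroup.cmDatum L 1 (Matrix.of fun i j : Fin 1 => if i.val + j.val + 1 = 1 then (1 : L) else 0)).Local v)
    {t : (UnitaryGroup.cmDatum L 3 H').Local v} (ht : IsLocalNormPair L H' v a t) {s : ℤ} (hs : s = 1 ∨ s = -1) (hκ : finKappaAt L v H' a t = s)
    {C : ℂ} (hΔ : finExplicitDelta L v H' a μ t = C * ((finKappaAt L v H' a t : ℤ) : ℂ)) :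
    finTau L v a μ * (finWeylRatio L v a : ℂ) = C := by
  have hκ0 : ((finKappaAt L v H' a t : ℤ) : ℂ) ≠ 0 := by
    rw [hκ]; rcases hs with h | h <;> simp [h]
  have h := finExplicitDelta_of_isLocalNormPair L v H' a μ ht
  rw [hΔ] at h
  exact (mul_right_cancel₀ hκ0 h).symm

/-! ## §2 The `G′`-side of the type-(1) clause with the factor evaluated at a tame place -/

variable (hμω : ∀ x : ideleGroup ↥(maximalRealSubfield L), μ (AdeleRing.ideleBaseChange ↥(maximalRealSubfield L) L x) = quadraticHeckeCharCM L x)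

include hw hμω in
open scoped Classical in
/-- **`∑ᶠ c, Δ‴_v(γ_H, out c)·Φ(c, f) = (β(γ_H), θ)_v · q_v^{−m} · s · ∑_b (−1)^{b₁}·Φ(⟦t_b⟧, f)` NEAR `1`, AT A TAME NON-SPLIT PLACE (ramified allowed).**  There is `V ∈ 𝓝 1` in
`H_v` such that for every `γ_H ∈ V` with depth token `|χ_g(u)_w|_w = |ι_w ϖ_v|_w^m`, every `β ∈ L⁺_v^×` with `ι_w β = −χ_g(u)_w(u_w² + det g_w)∕(2u_w² det g_w)` (T5-u-TAME's
symmetrised discriminant), every family `t : Fin 2 → Fin 2 → G′_v` of representatives MATCHED with `γ_H`, pairwise NON-CONJUGATE, with a one-place type-(1) eigenframe of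
`t 0 0` (★ `exists_four_ramified_representatives` supplies all of this at a tame-ramified `w`) and signs `κ_v(γ_H, t_b) = s·(−1)^{b₁}`, `s = ±1` (★ `finKappaAt_ramified_representative_eq`:
`s = χ(−det H′_w)`), and every test function ∕ orbital-measure family:
`∑ᶠ c, Δ‴_v(γ_H, out c)·Φ(c, f) = (β, θ)_v · (q_v^m)⁻¹ · s · ∑_{b₀} ∑_{b₁} (−1)^{b₁}·Φ(⟦t b₀ b₁⟧, f)`.  (★ p847076 assembly + ★ T5-u-TAME germ + §1.)
[cite: Rogawski1990, §4.9 p. 55, Prop. 4.9.1; §4.3 (4.3.1)–(4.3.2) p. 43; Prop. 8.1.3 p. 116] [cite: LabesseLanglands1979, §2 (2.1)–(2.2)] [cite: Flicker1998UnitaryFL, §6 p. 95] -/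
theorem exists_nhds_one_forall_finsum_delta_eq_hilbertSymbol_mul_signed_sum
    [∀ γ : (UnitaryGroup.cmDatum L 3 H').Local v,
      MeasurableSpace (((UnitaryGroup.cmDatum L 3 H').Local v) ⧸ Subgroup.centralizer ({γ} : Set ((UnitaryGroup.cmDatum L 3 H').Local v)))]
    (h2 : Valued.v (2 : w.1.adicCompletion L) = 1)
    (hH : (((UnitaryGroup.adelicForm L 3 H').map (UnitaryGroup.adeleToLocal L v)).map
      (UnitaryGroup.conjLocal L (IsCMField.complexConj L) v))ᵀ = (UnitaryGroup.adelicForm L 3 H').map (UnitaryGroup.adeleToLocal L v))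
    (hHd : IsUnit ((UnitaryGroup.adelicForm L 3 H').map (UnitaryGroup.adeleToLocal L v)).det) :
    ∃ V ∈ 𝓝 (1 : (UnitaryGroup.cmDatum L 2 (Matrix.of fun i j : Fin 2 => if i.val + j.val + 1 = 2 then (1 : L) else 0)).Local v ×
        (UnitaryGroup.cmDatum L 1 (Matrix.of fun i j : Fin 1 => if i.val + j.val + 1 = 1 then (1 : L) else 0)).Local v),
      ∀ a ∈ V, ∀ (m : ℕ),
        Valued.v (((finCharpolyTwo L v a).eval (finGammaTwo L v a)) w) =
          Valued.v ((toPlace v w (HeckeCharacter.uniformizer ↥(maximalRealSubfield L) v : v.adicCompletion ↥(maximalRealSubfield L))) ^ m) →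
        ∀ β : (v.adicCompletion ↥(maximalRealSubfield L))ˣ,
          toPlace v w (β : v.adicCompletion ↥(maximalRealSubfield L)) =
            -(((finCharpolyTwo L v a).eval (finGammaTwo L v a)) w *
                (finGammaTwo L v a w ^ 2 +
                  ((a.1.val.val : Matrix (Fin 2) (Fin 2) (UnitaryGroup.LocalRing L v)).map
                    (Pi.evalRingHom (fun w' : UnitaryGroup.PlacesOver L v => w'.1.adicCompletion L) w)).det)) /
              (2 * finGammaTwo L v a w ^ 2 *
                ((a.1.val.val : Matrix (Fin 2) (Fin 2) (UnitaryGroup.LocalRing L v)).map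
                  (Pi.evalRingHom (fun w' : UnitaryGroup.PlacesOver L v => w'.1.adicCompletion L) w)).det) →
        ∀ {t : Fin 2 → Fin 2 → (UnitaryGroup.cmDatum L 3 H').Local v},
          (∀ b₀ b₁, IsLocalNormPair L H' v a (t b₀ b₁)) →
          (∀ b₀ b₁ b₀' b₁', IsConj (t b₀ b₁) (t b₀' b₁') → b₀ = b₀' ∧ b₁ = b₁') →
        ∀ {Q : GL (Fin 3) (w.1.adicCompletion L)} {x : Fin 3 → w.1.adicCompletion L},
          (((localNonsplitEquiv (IsCMField.complexConj L) H' (IsCMField.complexConj_ne_one L) w hw (t 0 0)).val :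
              GL (Fin 3) (w.1.adicCompletion L)) : Matrix (Fin 3) (Fin 3) (w.1.adicCompletion L)) * Q.val = Q.val * diagonal x →
          Function.Injective x → (∀ i, galAdicCompletionMap (L := L) (IsCMField.complexConj L) hw (x i) * x i = 1) →
        ∀ {s : ℤ}, (s = 1 ∨ s = -1) → (∀ b₀ b₁, finKappaAt L v H' a (t b₀ b₁) = s * (-1) ^ (b₁ : ℕ)) →
        ∀ (mG : OrbitalMeasureFamily ((UnitaryGroup.cmDatum L 3 H').Local v)) (f : (UnitaryGroup.cmDatum L 3 H').Local v → ℂ),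
          ∑ᶠ c : ConjClasses ((UnitaryGroup.cmDatum L 3 H').Local v),
              (finExplicitCollection L H' μ (finExplicitDelta_conj_left_all L H' μ) (finExplicitDelta_conj_right_all L H' μ) v).Δ a (Quotient.out c) *
                classOrbitalIntegral mG f c =
            (hilbertSymbol (v.adicCompletion ↥(maximalRealSubfield L)) (β : v.adicCompletion ↥(maximalRealSubfield L))
                (algebraMap ↥(maximalRealSubfield L) _ ((cmQuadraticGenerator L : 𝓞 ↥(maximalRealSubfield L)) : ↥(maximalRealSubfield L))) : ℂ) *
              (((Nat.card (𝓞 ↥(maximalRealSubfield L) ⧸ v.asIdeal) : ℂ) ^ m))⁻¹ * (s : ℂ) *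
              ∑ b₀ : Fin 2, ∑ b₁ : Fin 2, (-1 : ℂ) ^ (b₁ : ℕ) * classOrbitalIntegral mG f (ConjClasses.mk (t b₀ b₁)) := by
  obtain ⟨V, hV, hT5⟩ := exists_nhds_one_forall_finExplicitDelta_eq_hilbertSymbol_mul L v w hw μ hμω h2 H'
  refine ⟨V, hV, fun a ha m hm β hβ t hmatch hinj Q x hQ hx hx1 s hs hκ mG f => ?_⟩
  -- the assembly: `Σᶠ = τ·D · Σ_b κ_b Φ_b`
  rw [finsum_delta_mul_classOrbitalIntegral_eq_mul_sum_kappa_of_four_representatives_of_onePlace_frame L v H' a w hw μ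
    (finExplicitDelta_conj_left_all L H' μ) (finExplicitDelta_conj_right_all L H' μ) hmatch hinj hH hHd hQ hx hx1 mG f]
  -- the factor: `τ·D = (β, θ)_v · q^{−m}` read off `t 0 0`
  have hfac := finTau_mul_finWeylRatio_eq_of_finExplicitDelta_eq L v H' μ a (hmatch 0 0) hs (by rw [hκ 0 0]; simp) (hT5 a ha m (t 0 0) hm β hβ (hmatch 0 0))
  have hsum : (∑ b₀ : Fin 2, ∑ b₁ : Fin 2, ((finKappaAt L v H' a (t b₀ b₁) : ℤ) : ℂ) * classOrbitalIntegral mG f (ConjClasses.mk (t b₀ b₁))) =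
      (s : ℂ) * ∑ b₀ : Fin 2, ∑ b₁ : Fin 2, (-1 : ℂ) ^ (b₁ : ℕ) * classOrbitalIntegral mG f (ConjClasses.mk (t b₀ b₁)) := by
    rw [Finset.mul_sum]
    refine Finset.sum_congr rfl fun b₀ _ => ?_
    rw [Finset.mul_sum]
    refine Finset.sum_congr rfl fun b₁ _ => ?_
    rw [hκ b₀ b₁]
    push_cast
    ring
  rw [hfac, hsum]
  ring

end Literals

end Literature.NumberTheory.Rogawski1990

end
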